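import Summits.BirchSwinnertonDyer.Rank1Residual.F1Sign2.HondaSystemAtTwo
import Summits.BirchSwinnertonDyer.Rank1Residual.Supersingular.FrobeniusTraceTwoParity
import Literature.NumberTheory.EllipticCurves.CyclotomicZpExtensionLocalGeneratorProofs
import Literature.NumberTheory.EllipticCurves.Rank1Residual.Predicates
import HarnessLib

/-!
# Route `ByReductionTypeAtTwo` (rung K4), crux `SupersingularRankZeroAtTwo` (item stmt-BirchSwinnertonDyer-19097), stub 2
# `stub_allFlatData` of line `odd_blind_package` v2.14: its first SIX conjuncts (local lift `g` of `γ`, Sprung's local points `c_n` on the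
# layers, the trace relations, (INJ)/(SAT) at level `0`, the Honda legality clause) FOLLOW IN THE KERNEL from the single typed obligation
# (C1) `F1Sign2.HondaSystemAtTwoExists` (Sprung 2012 Thm. 2.2 at `p = 2`) — so the research content of stub 2 is EXACTLY (C1) ∧ COUNT♭ ∧ CK♭

HONEST FRAMING (cell `bsd-2adic`, run/shared/lean/pub/bsd-2adic/, seat `bsd-2adic-ss-1` GEN 24 = LEAD lineage of 19097; HUMAN RULINGS
D-0036 / D-0054 / D-0074): THEOREMS ONLY (no definition, no named fact, no instance, no `sorry`, axioms the standard trio); CONDITIONAL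
on the displayed Summits-side obligation `F1Sign2.HondaSystemAtTwoExists` (a `def … : Prop` of cell `bsd-f1-sign2`, KNOWN-shaped:
Kobayashi 2003 Prop. 8.11/8.12 ∘ Sprung 2012 Thm. 2.2 with the `p = 2` bottom relations; REF1 §139 (B0) certified; NOT proved in the tree);
closes no stub (stub 2 also asserts COUNT♭ and CK♭); nothing booked; BSD is not proved by any of this.

WHAT.  `UniformFlatHondaDataAtTwo` (stub 2, registry v2.14 bb48bf0d…) asks, for every curve of the habitat, every cyclotomic `(κ, γ)` and the
place `v ∋ 2`, for `∃ (g, c)` with NINE conjuncts.  Conjuncts (1)–(6) are: (1) `g` lifts `γ`; (2) `c n ∈ E(ℚ_{n,v})`; (3) Sprung's trace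
relations `Tr_{n+1/n} c_{n+1} = a₂ c_n − c_{n−1}` (`n ≥ 1`); (4) (INJ) a functional on `E(ℚ_{0,v})` vanishing at `c 0` is `0`; (5) (SAT)
`2`-saturation of the values at `c 0`; (6) `∃ cneg, IsHondaSystemAtTwo κ ι W a₂ g cneg c`.  A Honda system at two (the body of (6)) CONTAINS
(2), (3) and (INJ)/(SAT) for `cneg`, and `c 0 = (a₂² − 2a₂ − 1) • cneg` with `a₂² − 2a₂ − 1 ∈ {−1, −1, 7}` for `a₂ ∈ {0, 2, −2}`
(`frobeniusTrace_two_eq_zero_or`) — a `2`-adic UNIT — so (INJ)/(SAT) transfer from `cneg` to `c 0`; (1) is the tree theorem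
`ZpExtension.IsCyclotomic.exists_isTopGenerator_resGalOfEmb_adicCompletion`.  Hence
`flatLocalData_of_hondaSystemAtTwoExists : HondaSystemAtTwoExists → ‹conjuncts (1)–(6) of stub 2, binders VERBATIM›`.

References: F. Sprung, J. Number Theory 132 (2012) 1483–1506, Thm. 2.2, Lemma 2.3, Lemma 7.9; S. Kobayashi, Invent. Math. 152 (2003),
Prop. 8.11–8.12; cell memo MEMO-imc §10.90 (the `p = 2` bottom relations).
-/

set_option autoImplicit false
-- the Theorems namespace of this sub repeats the summit name by design (D-0017 nested layout: Summit.<S>.<Sub>)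
set_option linter.dupNamespace false

noncomputable section

open scoped Classical NumberField

namespace Summit.BirchSwinnertonDyer.BirchSwinnertonDyer.Theorems.SSFlatLocalData

open NumberField IsDedekindDomain WeierstrassCurve Literature.NumberTheory.EllipticCurves
  Literature.NumberTheory.EllipticCurves.ZpExtension Literature.NumberTheory.EllipticCurves.Sprung2012
  Literature.NumberTheory.EllipticCurves.Kobayashi2003 Literature.NumberTheory.GaloisRepresentations
  Literature.NumberTheory.EllipticCurves.Rank1Residual
  Summit.BirchSwinnertonDyer.Rank1Residual Summit.BirchSwinnertonDyer.Rank1Residual.F1Sign2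

/-! ## §1 The `2`-adic unit `a₂² − 2a₂ − 1` -/

/-- For `a ∈ {0, 2, −2}` (the supersingular traces at `2`), `a² − 2a − 1 ∈ {−1, −1, 7}` is ODD. [folklore] -/
theorem not_two_dvd_sq_sub (a : ℤ) (ha : a = 0 ∨ a = 2 ∨ a = -2) : ¬ (2 : ℤ) ∣ a ^ 2 - 2 * a - 1 := by
  rcases ha with rfl | rfl | rfl <;> decide

/-- An odd integer is a unit of `ℤ₂` (`‖k‖ < 1 ↔ 2 ∣ k`). [folklore] -/
theorem isUnit_intCast_padicInt_two {k : ℤ} (hk : ¬ (2 : ℤ) ∣ k) : IsUnit ((k : ℤ_[2])) := by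
  rw [PadicInt.isUnit_iff]
  have hle : ‖((k : ℤ_[2]))‖ ≤ 1 := PadicInt.norm_le_one _
  have hlt : ¬ ‖((k : ℤ_[2]))‖ < 1 := fun h ↦ hk (by exact_mod_cast (PadicInt.norm_int_lt_one_iff_dvd k).mp h)
  exact le_antisymm hle (not_lt.mp hlt)

/-! ## §2 (INJ)/(SAT) transfer along a unit multiple -/

variable {K : Type} [Field K] {E : Type} [Field E] [Algebra K E] (W : WeierstrassCurve K)

/-- A functional's value at `u • P` is `u` times its value at `P` (both in the subgroup `A`). [folklore] -/
theorem evalOn_zsmul (A : AddSubgroup (localPoints W E)) (z : A →+ ℤ_[2]) {P : localPoints W E} (hP : P ∈ A) (u : ℤ) :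
    evalOn W A z (u • P) = (u : ℤ_[2]) * evalOn W A z P := by
  rw [evalOn_of_mem W A z (A.zsmul_mem hP u), evalOn_of_mem W A z hP, ← zsmul_eq_mul, ← map_zsmul]
  rfl

/-- **(INJ) transfers along a unit multiple**: if every functional vanishing at `P` is zero and `Q = u • P` with `u` odd, then every
functional vanishing at `Q` is zero. [folklore] -/
theorem inj_of_inj_zsmul (A : AddSubgroup (localPoints W E)) {P Q : localPoints W E} (hP : P ∈ A) {u : ℤ}
    (hu : ¬ (2 : ℤ) ∣ u) (hQ : Q = u • P) (hinj : ∀ z : A →+ ℤ_[2], evalOn W A z P = 0 → z = 0)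
    (z : A →+ ℤ_[2]) (hz : evalOn W A z Q = 0) : z = 0 := by
  rw [hQ, evalOn_zsmul W A z hP u] at hz
  exact hinj z ((isUnit_intCast_padicInt_two hu).mul_right_eq_zero.mp hz)

/-- **(SAT) transfers along a unit multiple**: `2`-saturation of the values at `P` gives `2`-saturation of the values at `Q = u • P`,
`u` odd. [folklore] -/
theorem sat_of_sat_zsmul (A : AddSubgroup (localPoints W E)) {P Q : localPoints W E} (hP : P ∈ A) {u : ℤ}
    (hu : ¬ (2 : ℤ) ∣ u) (hQ : Q = u • P)
    (hsat : ∀ a : ℤ_[2], (∃ z : A →+ ℤ_[2], evalOn W A z P = 2 * a) → ∃ y : A →+ ℤ_[2], evalOn W A y P = a)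
    (a : ℤ_[2]) (ha : ∃ z : A →+ ℤ_[2], evalOn W A z Q = 2 * a) :
    ∃ y : A →+ ℤ_[2], evalOn W A y Q = a := by
  obtain ⟨w, hw⟩ := isUnit_intCast_padicInt_two hu
  obtain ⟨z, hz⟩ := ha
  rw [hQ, evalOn_zsmul W A z hP u, ← hw] at hz
  -- `z(P) = w⁻¹ · 2a = 2 · (w⁻¹ a)`
  have hzP : evalOn W A z P = 2 * ((w⁻¹ : ℤ_[2]ˣ) * a) := by
    have h := congrArg (fun t ↦ ((w⁻¹ : ℤ_[2]ˣ) : ℤ_[2]) * t) hz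
    simp only [← mul_assoc, Units.inv_mul, one_mul] at h
    rw [h]
    ring
  obtain ⟨y, hy⟩ := hsat _ ⟨z, hzP⟩
  refine ⟨y, ?_⟩
  rw [hQ, evalOn_zsmul W A y hP u, ← hw, hy, ← mul_assoc, Units.mul_inv, one_mul]

/-! ## §3 Conjuncts (1)–(6) of stub 2 from (C1) -/

/-- ★ **The first six conjuncts of `UniformFlatHondaDataAtTwo` (stub 2 of line `odd_blind_package` v2.14) follow from (C1)
`F1Sign2.HondaSystemAtTwoExists`** — binders VERBATIM those of the stub (`¬CM` and `r_an = 0` are carried, unused): the local lift `g`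
is `exists_isTopGenerator_resGalOfEmb_adicCompletion`; the Honda system at two supplies `c`, the layers, the trace relations and the clause
(6) itself; (INJ)/(SAT) at `c 0 = (a₂² − 2a₂ − 1) • cneg` transfer from `cneg` along the odd integer `a₂² − 2a₂ − 1`
(`frobeniusTrace_two_eq_zero_or`).  So stub 2 = (C1) ∧ COUNT♭ ∧ CK♭ exactly.  CONDITIONAL on (C1); nothing else displayed.
[cite: Sprung2012, Thm. 2.2 and Lemma 7.9 (pp. 1487, 1503)] [cite: Kobayashi2003, Prop. 8.12] -/
theorem flatLocalData_of_hondaSystemAtTwoExists (hC1 : HondaSystemAtTwoExists) :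
    ∀ (W : WeierstrassCurve ℚ) [W.IsElliptic] [W.IsGloballyMinimal],
      ¬ W.HasCM → W.analyticRank = 0 → GoodSS W 2 →
      ∀ (κ : ZpExtension ℚ 2) (γ : Field.absoluteGaloisGroup ℚ),
        κ.IsCyclotomic → κ.IsTopGenerator γ → IsCyclotomicVariable 2 γ →
      ∀ (v : HeightOneSpectrum (𝓞 ℚ)), (2 : 𝓞 ℚ) ∈ v.asIdeal →
      ∃ (g : Field.absoluteGaloisGroup (v.adicCompletion ℚ)) (c : ℕ → localPoints W (v.adicCompletion ℚ)),
        κ.IsTopGenerator (resGalOfEmb (closureEmb (K := ℚ) (v.adicCompletion ℚ)) g) ∧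
        (∀ n, c n ∈ localLayerPointsOfEmb κ (closureEmb (K := ℚ) (v.adicCompletion ℚ)) W n) ∧
        (∀ n, 1 ≤ n → localTraceOfEmb κ (closureEmb (K := ℚ) (v.adicCompletion ℚ)) W n (n + 1)
          (c (n + 1)) = W.frobeniusTrace 2 • c n - c (n - 1)) ∧
        (∀ z₀ : localLayerPointsOfEmb κ (closureEmb (K := ℚ) (v.adicCompletion ℚ)) W 0 →+ ℤ_[2],
          evalOn W (localLayerPointsOfEmb κ (closureEmb (K := ℚ) (v.adicCompletion ℚ)) W 0) z₀ (c 0) = 0 →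
            z₀ = 0) ∧
        (∀ a : ℤ_[2],
          (∃ z₀ : localLayerPointsOfEmb κ (closureEmb (K := ℚ) (v.adicCompletion ℚ)) W 0 →+ ℤ_[2],
            evalOn W (localLayerPointsOfEmb κ (closureEmb (K := ℚ) (v.adicCompletion ℚ)) W 0) z₀ (c 0) =
              2 * a) →
          ∃ y : localLayerPointsOfEmb κ (closureEmb (K := ℚ) (v.adicCompletion ℚ)) W 0 →+ ℤ_[2],
            evalOn W (localLayerPointsOfEmb κ (closureEmb (K := ℚ) (v.adicCompletion ℚ)) W 0) y (c 0) = a) ∧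
        (∃ cneg : localPoints W (v.adicCompletion ℚ),
          IsHondaSystemAtTwo κ (closureEmb (K := ℚ) (v.adicCompletion ℚ)) W (W.frobeniusTrace 2) g cneg c) := by
  intro W _ _ _ _ hss κ γ hκ hγ hγ' v hv
  obtain ⟨g, hg⟩ := hκ.exists_isTopGenerator_resGalOfEmb_adicCompletion v hv
  obtain ⟨cneg, c, hH⟩ := hC1 W hss.1 hss.2 κ γ hκ hγ hγ' v hv g hg
  obtain ⟨hcneg, hc, hc0, _h01, hTr, hinj, hsat, _hgen⟩ := id hH
  have hodd : ¬ (2 : ℤ) ∣ W.frobeniusTrace 2 ^ 2 - 2 * W.frobeniusTrace 2 - 1 :=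
    not_two_dvd_sq_sub _ (Supersingular.frobeniusTrace_two_eq_zero_or W hss.1 hss.2)
  exact ⟨g, c, hg, hc, hTr,
    inj_of_inj_zsmul W _ hcneg hodd hc0 hinj,
    sat_of_sat_zsmul W _ hcneg hodd hc0 hsat,
    ⟨cneg, hH⟩⟩

end Summit.BirchSwinnertonDyer.BirchSwinnertonDyer.Theorems.SSFlatLocalData

end
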